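import Literature.MathematicalPhysics.QuantumFieldTheory.Balaban1983to89.B5Eq121HodgeIdentityVector
import Literature.MathematicalPhysics.QuantumFieldTheory.Balaban1983to89.T4WilsonLinkAffine
import HarnessLib

/-!
# Line «sandwich_discharge» on crux `HistoryTailL` (stmt-QuantumFields-19936), stub `stub_sandwichSweepGapCapped` (S′), B6 door item (δ) —
# «PLAQUETTE SUMS AGAINST ORDERED-PAIR SUMS»: `Σ_x Σ_a Σ_b f(x,a,b) = 2·Σ_{q : Plaq} f(q.src, q.μ, q.ν)` for symmetric `f` with zero diagonal,
# and the two instances the door uses (curl × antisymmetric field; curl squared), plus `c(b₁)+c(b₂)−c(b₃)−c(b₄) = (d₁c)(q)`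

Cell `ym3-torus` (YM ladder rung R3 = continuum SU(2) Yang–Mills on the three-torus — a RUNG, NOT the Clay problem); width seat `ym3-torus-px8` gen 7;
`--supports stmt-QuantumFields-19936` (helper).  THEOREMS ONLY (0 `def`, default heartbeats), literature-only imports.

WHY (px8 g7 memo «B6 DOOR v3» D5, item (δ)).  The action rows of the door ((R1) ✓`lin_sub_sharp_le_wilsonAction4_sub_mulField`, (r2-M), w5's sweep files) sum over
`q : Plaq (F.P K) 0` — ONE orientation per square (`q.μ < q.ν`, the tree's `Fintype (Plaq P k)`), with the amplitude entering as `c(bond₁ q) + c(bond₂ q) − c(bond₃ q) − c(bond₄ q)`;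
the profile socket ✓∕✍`CovariantDischargeProfileSocket.exists_profile_socket` sums over `x : Site, a b : Fin d` — ORDERED pairs — with the curl letter
`((aT ⟨x.shift a, b⟩ − aT ⟨x, b⟩) − (aT ⟨x.shift b, a⟩ − aT ⟨x, a⟩))`.  This file is the dictionary: §1 the generic `Fin`-pair lemma and the plaquette form (over lit
✓`B5Eq121HodgeIdentityVector.sum_plaq_eq`); §2 the curl letter is antisymmetric with zero diagonal, and equals the four-bond combination at a plaquette; §3 the two door
instances `Σ_xab (d₁c)·Φ = 2Σ_q (d₁c)_q·Φ_q` (`Φ` antisymmetric) and `Σ_xab (d₁c)² = 2Σ_q (d₁c)_q²`.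
HONEST SCOPE: finite-sum bookkeeping; nothing of B6∕S′∕`stub_sandwichSweepGapCapped`∕`HistoryTailL` proved or claimed; YM₃ on T³ is rung R3, not d = 4, not Clay.
[cite: Balaban1984PropagatorsI, (1.4) p.18 (bookkeeping)]
-/

noncomputable section

namespace Summit.QuantumFields.YangMills.Theorems.CovariantDischargePlaqPairSum

open scoped BigOperators
open Literature.MathematicalPhysics.QuantumFieldTheory.Balaban1983to89
open Literature.MathematicalPhysics.QuantumFieldTheory.Balaban1983to89.B5Eq121HodgeIdentityVector (sum_plaq_eq)
open Literature.MathematicalPhysics.QuantumFieldTheory.Balaban1983to89.T4WilsonLinkAffine (bond₁ bond₂ bond₃ bond₄)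

variable {P : Params} {k : ℕ}

/-! ## §1 Symmetric summands with zero diagonal: the ordered-pair sum is twice the `a < b` sum -/

/-- For `g : Fin n → Fin n → ℝ` symmetric with zero diagonal, `Σ_a Σ_b g a b = 2·Σ_a Σ_b [a < b]·g a b`. [folklore] -/
theorem sum_sum_eq_two_mul_sum_ite_lt {n : ℕ} (g : Fin n → Fin n → ℝ) (hg : ∀ a b, g b a = g a b) (hd : ∀ a, g a a = 0) :
    ∑ a, ∑ b, g a b = 2 * ∑ a, ∑ b, (if a < b then g a b else 0) := by
  have hsplit : ∀ a b, g a b = (if a < b then g a b else 0) + (if b < a then g a b else 0) := by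
    intro a b
    rcases lt_trichotomy a b with h | h | h
    · rw [if_pos h, if_neg (not_lt.mpr h.le), add_zero]
    · subst h; rw [if_neg (lt_irrefl _), hd, add_zero]
    · rw [if_neg (not_lt.mpr h.le), if_pos h, zero_add]
  have h1 : ∑ a, ∑ b, g a b = ∑ a, ∑ b, ((if a < b then g a b else 0) + (if b < a then g a b else 0)) :=
    Finset.sum_congr rfl fun a _ => Finset.sum_congr rfl fun b _ => hsplit a b
  have h2 : ∑ a, ∑ b, (if b < a then g a b else 0) = ∑ a, ∑ b, (if a < b then g a b else 0) := by
    rw [Finset.sum_comm]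
    exact Finset.sum_congr rfl fun a _ => Finset.sum_congr rfl fun b _ => by rw [hg]
  rw [h1]
  simp only [Finset.sum_add_distrib]
  rw [h2, two_mul]

/-- ★ **PLAQUETTE FORM**: for `f : Site → Fin d → Fin d → ℝ` symmetric in the two directions with zero diagonal,
`Σ_x Σ_a Σ_b f x a b = 2·Σ_{q : Plaq P k} f q.src q.μ q.ν`. [cite: Balaban1984PropagatorsI, (1.4) p.18 (bookkeeping)] -/
theorem sum_eq_two_mul_sum_plaq (f : Site P k → Fin P.d → Fin P.d → ℝ) (hf : ∀ x a b, f x b a = f x a b) (hd : ∀ x a, f x a a = 0) :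
    ∑ x : Site P k, ∑ a, ∑ b, f x a b = 2 * ∑ q : Plaq P k, f q.src q.μ q.ν := by
  rw [sum_plaq_eq, Finset.mul_sum]
  exact Finset.sum_congr rfl fun x _ => sum_sum_eq_two_mul_sum_ite_lt (f x) (hf x) (hd x)

/-! ## §2 The curl letter: antisymmetric, zero diagonal, and equal to the four-bond combination at a plaquette -/

/-- The curl letter is antisymmetric in the two directions. [folklore] -/
theorem curl_swap (c : PBond P k → ℝ) (x : Site P k) (a b : Fin P.d) :
    (c ⟨x.shift b, a⟩ - c ⟨x, a⟩) - (c ⟨x.shift a, b⟩ - c ⟨x, b⟩) = -((c ⟨x.shift a, b⟩ - c ⟨x, b⟩) - (c ⟨x.shift b, a⟩ - c ⟨x, a⟩)) := by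
  ring

/-- The curl letter vanishes on the diagonal. [folklore] -/
theorem curl_diag (c : PBond P k → ℝ) (x : Site P k) (a : Fin P.d) :
    (c ⟨x.shift a, a⟩ - c ⟨x, a⟩) - (c ⟨x.shift a, a⟩ - c ⟨x, a⟩) = 0 := sub_self _

/-- ★ **THE FOUR-BOND COMBINATION IS THE CURL LETTER**: `c(bond₁ q) + c(bond₂ q) − c(bond₃ q) − c(bond₄ q) = (c⟨x+e_μ,ν⟩ − c⟨x,ν⟩) − (c⟨x+e_ν,μ⟩ − c⟨x,μ⟩)`, `x = q.src`.
[cite: Balaban1984PropagatorsI, (1.4) p.18 (bookkeeping)] -/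
theorem bond_sum_eq_curl (c : PBond P k → ℝ) (q : Plaq P k) :
    c (bond₁ q) + c (bond₂ q) - c (bond₃ q) - c (bond₄ q) =
      (c ⟨q.src.shift q.μ, q.ν⟩ - c ⟨q.src, q.ν⟩) - (c ⟨q.src.shift q.ν, q.μ⟩ - c ⟨q.src, q.μ⟩) := by
  simp only [bond₁, bond₂, bond₃, bond₄]
  ring

/-! ## §3 The two door instances -/

/-- ★ **CURL × ANTISYMMETRIC FIELD**: for `Φ` antisymmetric in the directions,
`Σ_x Σ_a Σ_b (d₁c)(x,a,b)·Φ x a b = 2·Σ_q (c(b₁)+c(b₂)−c(b₃)−c(b₄))·Φ q.src q.μ q.ν`. [cite: Balaban1984PropagatorsI, (1.4) p.18 (bookkeeping)] -/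
theorem sum_curl_mul_eq_two_mul_sum_plaq (c : PBond P k → ℝ) (Φ : Site P k → Fin P.d → Fin P.d → ℝ) (hΦ : ∀ x a b, Φ x b a = -Φ x a b) :
    ∑ x : Site P k, ∑ a, ∑ b, ((c ⟨x.shift a, b⟩ - c ⟨x, b⟩) - (c ⟨x.shift b, a⟩ - c ⟨x, a⟩)) * Φ x a b =
      2 * ∑ q : Plaq P k, (c (bond₁ q) + c (bond₂ q) - c (bond₃ q) - c (bond₄ q)) * Φ q.src q.μ q.ν := by
  rw [sum_eq_two_mul_sum_plaq (fun x a b => ((c ⟨x.shift a, b⟩ - c ⟨x, b⟩) - (c ⟨x.shift b, a⟩ - c ⟨x, a⟩)) * Φ x a b)]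
  · congr 1
    exact Finset.sum_congr rfl fun q _ => by rw [bond_sum_eq_curl]
  · intro x a b
    rw [hΦ x a b, curl_swap c x a b]
    ring
  · intro x a
    have h0 : Φ x a a = 0 := by have := hΦ x a a; linarith
    rw [h0, mul_zero]

/-- ★ **CURL SQUARED**: `Σ_x Σ_a Σ_b (d₁c)(x,a,b)² = 2·Σ_q (c(b₁)+c(b₂)−c(b₃)−c(b₄))²`. [cite: Balaban1984PropagatorsI, (1.4) p.18 (bookkeeping)] -/
theorem sum_curl_sq_eq_two_mul_sum_plaq (c : PBond P k → ℝ) :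
    ∑ x : Site P k, ∑ a, ∑ b, ((c ⟨x.shift a, b⟩ - c ⟨x, b⟩) - (c ⟨x.shift b, a⟩ - c ⟨x, a⟩)) ^ 2 =
      2 * ∑ q : Plaq P k, (c (bond₁ q) + c (bond₂ q) - c (bond₃ q) - c (bond₄ q)) ^ 2 := by
  rw [sum_eq_two_mul_sum_plaq (fun x a b => ((c ⟨x.shift a, b⟩ - c ⟨x, b⟩) - (c ⟨x.shift b, a⟩ - c ⟨x, a⟩)) ^ 2)]
  · congr 1
    exact Finset.sum_congr rfl fun q _ => by rw [bond_sum_eq_curl]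
  · intro x a b
    rw [curl_swap c x a b, neg_sq]
  · intro x a
    rw [curl_diag, sq, mul_zero]

/-- ★ **CURL ℓ¹ MASS AGAINST THE BOND ℓ¹ MASS** (door D6∕D7 bookkeeping): `Σ_q |c(b₁)+c(b₂)−c(b₃)−c(b₄)| ≤ Σ_q (|c b₁| + |c b₂| + |c b₃| + |c b₄|)`. [folklore] -/
theorem sum_abs_bond_sum_le (c : PBond P k → ℝ) :
    ∑ q : Plaq P k, |c (bond₁ q) + c (bond₂ q) - c (bond₃ q) - c (bond₄ q)| ≤
      ∑ q : Plaq P k, (|c (bond₁ q)| + |c (bond₂ q)| + |c (bond₃ q)| + |c (bond₄ q)|) := by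
  refine Finset.sum_le_sum fun q _ => ?_
  calc |c (bond₁ q) + c (bond₂ q) - c (bond₃ q) - c (bond₄ q)|
      ≤ |c (bond₁ q) + c (bond₂ q) - c (bond₃ q)| + |c (bond₄ q)| := abs_sub _ _
    _ ≤ |c (bond₁ q) + c (bond₂ q)| + |c (bond₃ q)| + |c (bond₄ q)| := by linarith [abs_sub (c (bond₁ q) + c (bond₂ q)) (c (bond₃ q))]
    _ ≤ |c (bond₁ q)| + |c (bond₂ q)| + |c (bond₃ q)| + |c (bond₄ q)| := by linarith [abs_add_le (c (bond₁ q)) (c (bond₂ q))]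

end Summit.QuantumFields.YangMills.Theorems.CovariantDischargePlaqPairSum
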